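import Literature.Barriers.CriticalPhenomena.LaceExpansionIsingDeconvolutionBootstrap
import Literature.Barriers.CriticalPhenomena.LaceExpansionIsingDeconvolutionFourier
import Literature.Barriers.CriticalPhenomena.LaceExpansionIsingDeconvolutionCriticalSum
import Literature.Barriers.CriticalPhenomena.LaceExpansionIsingDeconvolutionPartsInfrared
import Literature.Barriers.CriticalPhenomena.LaceExpansionIsingDeconvolutionPartsProofs
import Literature.Barriers.CriticalPhenomena.LaceExpansionKernelFourier
import Literature.Barriers.CriticalPhenomena.LaceExpansionIsingExpansionBounds
import Mathlib.Analysis.SpecialFunctions.Pow.Asymptotics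
import HarnessLib

/-!
# Liu–Slade's Theorem 1.7 assembled from the named inputs of its printed proof:
# `LiuSlade2026_thm1_7_of_parts`

Barrier catalogue `Literature/Barriers/CriticalPhenomena/` (D-0021). The named fact
`SpreadOutIsing.LiuSlade2026_thm1_7` (`LaceExpansionIsingDeconvolution.lean`, Part G: Liu–Slade
2026, Theorem 1.7 with its error display (1.21), corrected transcription) is here PROVED from the
named facts of `LaceExpansionIsingDeconvolutionParts.lean` — the deep inputs of its printed proof,
Liu–Slade 2026, §1.3: "we prove our main result Theorem 1.7 subject to a general Gaussian
deconvolution theorem (Theorem 2.2), Proposition 1.2, and Proposition 1.6" —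

`LiuSlade2026_thm1_7_of_parts : LiuSlade2026_thm22 → LiuSlade2026_infraredBound →
  LiuSlade2026_prop12_asymp → srwGreen_asymp → LiuSlade2026_prop41 → LiuSlade2024_thm12_critical →
  LiuSlade2026_thm1_7`,

i.e. from Theorem 2.2 (with the absolute convergence of (2.1)), the infrared bound (2.3),
Proposition 1.2 (1.9) with the asymptotics (1.8) of `C_1` (only through
`S_1(x)|x|^{d-2} → a_d/σ²`; the bound (1.10) is a hypothesis of Theorem 1.7 as transcribed),
Proposition 4.1 (⊇ Proposition 1.6), and Liu–Slade 2024, Theorem 1.2 in the critical case (for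
(1.21)). Everything else in §2.2 is a theorem of the tree: the forbidden-interval argument
(`LaceExpansionIsingDeconvolutionBootstrap.lean`), the estimates (2.5)–(2.6)
(`…PartsEstimates.lean`), Fourier inversion on `ℓ¹` and `ℓ²` (`…Fourier.lean`), the criticality
`F̂_{z_c}(0) = 0` (the `x`-space theorem `tsum_eq_zero_of_latticeConv_eq_delta0` of
`…CriticalSum.lean`, fed with the second moment of `F_{z_c}` and the bootstrap decay of `G_{z_c}`),
and the transience of the spread-out walk (`LaceExpansionIsingRandomWalkBound.lean`); two of the six
inputs are meanwhile theorems too (`LiuSlade2026_infraredBound_holds`, `LiuSlade2026_prop41_holds`).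

## Contents (all proved)

* preliminaries: `summable_abs_lsF`, `summable_sq_mul_abs_lsF`, `isZdSymmetric_lsF`, `exists_lsF_le_div_jnorm` (the decay of
  `F_z`, with an `L`-dependent constant, for Liu–Slade 2024's Assumption 1.1),
  `exists_bound_of_lsBootstrapLE`, `summable_sq_of_lsBootstrapLE` (`b(z) ≤ t` and `d > 4` give
  `G_z ∈ ℓ²`), `tendsto_soGreen_one_mul_rpow` (`S_1(x)|x|^{d-2} → a_d/σ²` from (1.9) and (1.8)),
  `min_mul_sum_sq_ge` (the torus-norm bookkeeping for Liu–Slade 2024's infrared hypothesis);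
* `exists_impulse_of_assumptionH` — **Proposition 1.6 from Proposition 4.1** at one `z`
  (`β₀ = |K_h|L^{-(2-ε)}`, `β₁ = |K_h|L^{-(2-ε)}|o(1)|`, `θ = 2 + ρ`);
* the inputs at level `L`, packaged: `Thm22At`, `IRAt`, `EstimatesAt`, `ImpulseAt`;
* `bootstrap_implication` — **Proposition 2.3**: for `z < z_c`, `b(z) ≤ 3 ⇒ b(z) ≤ 2` ((2.14)–(2.17));
* `thm1_7_at_level` — the conclusion of Theorem 1.7 at one level `L` ((2.18)–(2.20), (1.21));
* `LiuSlade2026_thm1_7_of_parts` — the choice `ε₀ = 1` and of `L₂` ("for sufficiently large `L`,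
  independently of `z`"): `|o(1)| ≤ 1`, `β = C|K_h|L^{-(2-ε)}` below the thresholds of the inputs,
  and the bootstrap inequality (2.17);
* the trust base: `LiuSlade2026_thm1_7_of_four_facts` (the infrared bound and Prop. 4.1 being the
  tree's `LiuSlade2026_infraredBound_holds`, `LiuSlade2026_prop41_holds`),
  `Sakai2007_thm13_spreadOut_of_five_facts` (Prop. 1.2 (1.10) being the tree's
  `LiuSlade2026_prop12_greenBound_holds`), and `LaceExpansionIsingAboveFour_of_seven_facts`.

## References

* Y. Liu, G. Slade, *Gaussian deconvolution and the lace expansion for spread-out models*,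
  Ann. Inst. H. Poincaré Probab. Statist. 62 (2026), arXiv:2310.07640: §1.3; Prop. 1.6; §2.2:
  Prop. 2.3 and its proof ((2.14)–(2.17)), proof of Thm. 1.7 ((2.18)–(2.20)), (1.21) [LiuSlade2026].
* Y. Liu, G. Slade, *Gaussian deconvolution and the lace expansion*, Probab. Theory Related Fields
  195 (2024), arXiv:2310.07635: Assumption 1.1, Thm. 1.2 (1.14) [LiuSlade2024].
-/

noncomputable section

namespace Literature.Barriers.CriticalPhenomena.SpreadOutIsing

open Filter UnitAddTorus Literature.Probability.LatticeModels
open Literature.Analysis.FunctionSpaces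
open _root_.MeasureTheory _root_.Topology
open scoped ComplexConjugate ENNReal NNReal

section AssemblyPrelims

variable {d L : ℕ}

/-- `F_z = δ - zD - Π_z` is absolutely summable when `Π_z` is. [cite: LiuSlade2026, Assumption 2.1] -/
theorem summable_abs_lsF (z : ℝ) {P : Site d → ℝ} (hP : Summable fun x => |P x|) :
    Summable fun x => |lsF d L z P x| := by
  have hD : Summable fun x : Site d => |z * soStep d L x| := by
    simpa only [abs_mul] using summable_abs_soStep.mul_left |z|
  refine ((summable_abs_delta0.add hD).add hP).of_nonneg_of_le (fun x => abs_nonneg _) fun x => ?_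
  simp only [lsF]
  calc |delta0 x - z * soStep d L x - P x| ≤ |delta0 x - z * soStep d L x| + |P x| := abs_sub _ _
    _ ≤ |delta0 x| + |z * soStep d L x| + |P x| := by gcongr; exact abs_sub _ _

/-- `Σ_x |x|²|F_z(x)| < ∞` when `Π_z` has a finite absolute second moment (`δ` has none, `D` has
finite range). [cite: LiuSlade2026, Assumption 2.1] -/
theorem summable_sq_mul_abs_lsF (z : ℝ) {P : Site d → ℝ}
    (hP2 : Summable fun x => euclidNorm x ^ 2 * |P x|) :
    Summable fun x => euclidNorm x ^ 2 * |lsF d L z P x| := by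
  have hD : Summable fun x : Site d => euclidNorm x ^ 2 * |z * soStep d L x| := by
    refine summable_of_ne_finset_zero (s := (spreadOutGraph d L).neighborFinset 0) fun x hx => ?_
    rw [soStep_of_not_adj fun h => hx ((SimpleGraph.mem_neighborFinset _ _ _).2 h), mul_zero,
      abs_zero, mul_zero]
  refine (hD.add hP2).of_nonneg_of_le (fun x => by positivity) fun x => ?_
  have hδ : euclidNorm x ^ 2 * |delta0 x| = 0 := by
    by_cases hx : x = 0
    · subst hx; simp
    · rw [delta0_of_ne_zero hx, abs_zero, mul_zero]
  simp only [lsF]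
  have h1 : |delta0 x - z * soStep d L x - P x| ≤ |delta0 x| + |z * soStep d L x| + |P x| := by
    calc _ ≤ |delta0 x - z * soStep d L x| + |P x| := abs_sub _ _
      _ ≤ _ := by gcongr; exact abs_sub _ _
  calc euclidNorm x ^ 2 * |delta0 x - z * soStep d L x - P x|
      ≤ euclidNorm x ^ 2 * (|delta0 x| + |z * soStep d L x| + |P x|) :=
        mul_le_mul_of_nonneg_left h1 (sq_nonneg _)
    _ = euclidNorm x ^ 2 * |delta0 x| + (euclidNorm x ^ 2 * |z * soStep d L x| +
        euclidNorm x ^ 2 * |P x|) := by ring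
    _ = _ := by rw [hδ, zero_add]

/-- `F_z` is `ℤ^d`-symmetric when `Π_z` is. [cite: LiuSlade2026, Assumption 2.1] -/
theorem isZdSymmetric_lsF (z : ℝ) {P : Site d → ℝ} (hP : IsZdSymmetric P) :
    IsZdSymmetric (lsF d L z P) := by
  intro π ε x
  simp only [lsF, isZdSymmetric_delta0 π ε x, isZdSymmetric_soStep π ε x, hP π ε x]

/-- The finite-range step distribution decays at any polynomial rate (with an `L`-dependent
constant): `|D(x)| ≤ K/⟦x⟧^s`. [folklore] -/
theorem exists_soStep_le_div_jnorm (d L : ℕ) (s : ℝ) :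
    ∃ K : ℝ, 0 ≤ K ∧ ∀ x : Site d, |soStep d L x| ≤ K / jnorm x ^ s := by
  classical
  set Nb := (spreadOutGraph d L).neighborFinset 0 with hNb
  refine ⟨∑ y ∈ Nb, jnorm y ^ s, Finset.sum_nonneg fun y _ => Real.rpow_nonneg (jnorm_pos y).le _,
    fun x => ?_⟩
  by_cases hx : (spreadOutGraph d L).Adj 0 x
  · have hxN : x ∈ Nb := (SimpleGraph.mem_neighborFinset _ _ _).2 hx
    have hj : 0 < jnorm x ^ s := Real.rpow_pos_of_pos (jnorm_pos x) _
    rw [le_div_iff₀ hj, abs_of_nonneg (soStep_nonneg x)]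
    have h1 : soStep d L x ≤ 1 := by
      rw [soStep, if_pos hx]
      rcases Nat.eq_zero_or_pos (soCount d L) with h0 | h0
      · rw [h0]; simp
      · exact inv_le_one_of_one_le₀ (by exact_mod_cast h0)
    calc soStep d L x * jnorm x ^ s ≤ 1 * jnorm x ^ s :=
          mul_le_mul_of_nonneg_right h1 hj.le
      _ = jnorm x ^ s := one_mul _
      _ ≤ ∑ y ∈ Nb, jnorm y ^ s :=
          Finset.single_le_sum (fun y _ => Real.rpow_nonneg (jnorm_pos y).le _) hxN
  · rw [soStep_of_not_adj hx, abs_zero]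
    exact div_nonneg (Finset.sum_nonneg fun y _ => Real.rpow_nonneg (jnorm_pos y).le _)
      (Real.rpow_nonneg (jnorm_pos x).le _)

/-- `F_z` decays like its `Π_z` (with an `L`-dependent constant): `|F_z(x)| ≤ K₁/⟦x⟧^s`.
[cite: LiuSlade2024, Assumption 1.1 ((1.9), first bound)] -/
theorem exists_lsF_le_div_jnorm (z : ℝ) {P : Site d → ℝ} {β₀ β₁ s : ℝ} (hβ₀ : 0 ≤ β₀)
    (hP : ∀ x, |P x| ≤ β₀ * delta0 x + β₁ / jnorm x ^ s) :
    ∃ K₁ : ℝ, 0 < K₁ ∧ ∀ x : Site d, |lsF d L z P x| ≤ K₁ / jnorm x ^ s := by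
  obtain ⟨K, hK0, hK⟩ := exists_soStep_le_div_jnorm d L s
  have hPb := abs_le_div_jnorm_of_lsBound hβ₀ hP
  refine ⟨1 + |z| * K + |β₀ + β₁| + 1, by positivity, fun x => ?_⟩
  have hj : 0 < jnorm x ^ s := Real.rpow_pos_of_pos (jnorm_pos x) _
  have hδ : |delta0 x| ≤ 1 / jnorm x ^ s := by
    by_cases h0 : x = 0
    · subst h0; simp [jnorm_zero, delta0]
    · rw [delta0_of_ne_zero h0, abs_zero]; positivity
  simp only [lsF]
  calc |delta0 x - z * soStep d L x - P x|
      ≤ |delta0 x| + |z * soStep d L x| + |P x| := by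
        calc _ ≤ |delta0 x - z * soStep d L x| + |P x| := abs_sub _ _
          _ ≤ _ := by gcongr; exact abs_sub _ _
    _ ≤ 1 / jnorm x ^ s + |z| * (K / jnorm x ^ s) + (β₀ + β₁) / jnorm x ^ s := by
        gcongr
        · rw [abs_mul]; exact mul_le_mul_of_nonneg_left (hK x) (abs_nonneg z)
        · exact hPb x
    _ = (1 + |z| * K + (β₀ + β₁)) / jnorm x ^ s := by ring
    _ ≤ (1 + |z| * K + |β₀ + β₁| + 1) / jnorm x ^ s :=
        div_le_div_of_nonneg_right (by linarith [le_abs_self (β₀ + β₁)]) hj.le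

/-- `b(z) ≤ t` makes `G_z` bounded (`d ≥ 2`). [cite: LiuSlade2026, (1.12)] -/
theorem exists_bound_of_lsBootstrapLE {ε K_S : ℝ} {Gz : Site d → ℝ} {z t : ℝ} (hd : 2 ≤ d)
    (hK : 0 ≤ K_S) (ht : 0 ≤ t) (h : LSBootstrapLE d L ε K_S Gz z t) (h0 : ∀ x, 0 ≤ Gz x) :
    ∃ M : ℝ, ∀ x, |Gz x| ≤ M := by
  refine ⟨max (Gz 0) (t * (K_S * (L : ℝ) ^ (-(2 - ε)))), fun x => ?_⟩
  rw [abs_of_nonneg (h0 x)]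
  by_cases hx : x = 0
  · subst hx; exact le_max_left _ _
  · refine (h.1 x hx).trans (le_trans ?_ (le_max_right _ _))
    have hx1 : 1 ≤ euclidNorm x := one_le_euclidNorm_of_ne_zero hx
    have hd2 : -((d : ℝ) - 2) ≤ 0 := by
      have : (2 : ℝ) ≤ d := by exact_mod_cast hd
      linarith
    have hpow : euclidNorm x ^ (-((d : ℝ) - 2)) ≤ 1 := Real.rpow_le_one_of_one_le_of_nonpos hx1 hd2
    have hc : 0 ≤ t * (K_S * (L : ℝ) ^ (-(2 - ε))) :=
      mul_nonneg ht (mul_nonneg hK (Real.rpow_nonneg (Nat.cast_nonneg L) _))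
    calc t * (K_S * (L : ℝ) ^ (-(2 - ε)) * euclidNorm x ^ (-((d : ℝ) - 2)))
        = t * (K_S * (L : ℝ) ^ (-(2 - ε))) * euclidNorm x ^ (-((d : ℝ) - 2)) := by ring
      _ ≤ t * (K_S * (L : ℝ) ^ (-(2 - ε))) * 1 := mul_le_mul_of_nonneg_left hpow hc
      _ = _ := mul_one _

/-- **Proposition 1.6 from Proposition 4.1** (the reduction of the inhomogeneous lace expansion
to the impulse equation, at one value of `z`): under Assumption 1.5 at level `L` with
`b(z) ≤ 3`, and for `G_z` bounded, Prop. 4.1 (with `θ = 2 + ρ`, `β₀ = |K_h|L^{-(2-ε)}`,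
`β₁ = |K_h|L^{-(2-ε)}|o(1)|`) produces a `ℤ^d`-symmetric `Φ_z` with
`|Φ_z(x)| ≤ C|K_h|L^{-(2-ε)}((1 ∨ |o(1)|)δ_{0,x} + |o(1)|/⟦x⟧^{d+2+ρ})` and `F_z * G_z = δ`,
`F_z = δ - zD - Φ_z`, as soon as `|K_h|L^{-(2-ε)}(1 ∨ |o(1)|) ≤ β⋆`. [cite: LiuSlade2026, Proposition 1.6 and Proposition 4.1] -/
theorem exists_impulse_of_assumptionH (h41 : LiuSlade2026_prop41) (hd : 1 ≤ d) {ρ : ℝ} (hρ : 0 < ρ) :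
    ∃ βs : ℝ, 0 < βs ∧ ∃ C : ℝ, 0 ≤ C ∧
      ∀ (L : ℕ) (ε K_S K_h ηL zc z : ℝ) (G : ℝ → Site d → ℝ),
        |K_h| * (L : ℝ) ^ (-(2 - ε)) * max 1 |ηL| ≤ βs →
        LSAssumptionH d L ε K_S ρ K_h ηL G zc → z ∈ Set.Icc 1 zc →
        LSBootstrapLE d L ε K_S (G z) z 3 → (∃ M : ℝ, ∀ x, |G z x| ≤ M) →
        ∃ Φ : Site d → ℝ, IsZdSymmetric Φ ∧
          (∀ x, |Φ x| ≤ C * (|K_h| * (L : ℝ) ^ (-(2 - ε)) * max 1 |ηL|) * delta0 x +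
            C * (|K_h| * (L : ℝ) ^ (-(2 - ε)) * |ηL|) / jnorm x ^ ((d : ℝ) + 2 + ρ)) ∧
          ∀ x, latticeConv (lsF d L z Φ) (G z) x = delta0 x := by
  obtain ⟨βs, hβs, C, hC⟩ := h41 d hd (2 + ρ) (by linarith)
  refine ⟨βs, hβs, max C 0, le_max_right _ _, ?_⟩
  intro L ε K_S K_h ηL zc z G hsmall hH hz hb hbdd
  obtain ⟨h, hsymm, heq, hbound⟩ := hH z hz hb
  set a : ℝ := (L : ℝ) ^ (-(2 - ε)) with ha
  have ha0 : 0 ≤ a := Real.rpow_nonneg (Nat.cast_nonneg L) _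
  set β₀ : ℝ := |K_h| * a with hβ₀
  set β₁ : ℝ := |K_h| * a * |ηL| with hβ₁
  have hβ₀0 : 0 ≤ β₀ := by positivity
  have hβ₁0 : 0 ≤ β₁ := by positivity
  have hmax : max β₀ β₁ = |K_h| * a * max 1 |ηL| := by
    rw [hβ₀, hβ₁, mul_max_of_nonneg _ _ (by positivity : 0 ≤ |K_h| * a), mul_one]
  have hbound' : ∀ x, |h x - delta0 x| ≤ β₀ * delta0 x + β₁ / jnorm x ^ ((d : ℝ) + (2 + ρ)) := by
    intro x
    refine (hbound x).trans ?_
    have hj : 0 < jnorm x ^ ((d : ℝ) + 2 + ρ) := Real.rpow_pos_of_pos (jnorm_pos x) _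
    rw [show (d : ℝ) + (2 + ρ) = (d : ℝ) + 2 + ρ by ring, mul_add, hβ₀, hβ₁]
    refine add_le_add ?_ ?_
    · -- `K_h a δ ≤ |K_h| a δ`
      exact mul_le_mul_of_nonneg_right (mul_le_mul_of_nonneg_right (le_abs_self _) ha0)
        (delta0_nonneg x)
    · calc K_h * a * (ηL / jnorm x ^ ((d : ℝ) + 2 + ρ))
          ≤ |K_h * a * (ηL / jnorm x ^ ((d : ℝ) + 2 + ρ))| := le_abs_self _
        _ = |K_h| * a * (|ηL| / jnorm x ^ ((d : ℝ) + 2 + ρ)) := by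
            rw [abs_mul, abs_mul, abs_div, abs_of_nonneg ha0, abs_of_pos hj]
        _ = |K_h| * a * |ηL| / jnorm x ^ ((d : ℝ) + 2 + ρ) := by rw [mul_div_assoc]
  obtain ⟨Φ, hΦs, hΦb, himp⟩ := hC L z β₀ β₁ h hβ₀0 hβ₁0 (hmax ▸ hsmall) hsymm hbound'
  refine ⟨Φ, hΦs, fun x => ?_, himp (G z) hbdd heq⟩
  refine (hΦb x).trans ?_
  rw [hmax, show (d : ℝ) + (2 + ρ) = (d : ℝ) + 2 + ρ by ring]
  have hj : 0 < jnorm x ^ ((d : ℝ) + 2 + ρ) := Real.rpow_pos_of_pos (jnorm_pos x) _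
  have hCle : C ≤ max C 0 := le_max_left _ _
  refine add_le_add ?_ ?_
  · exact mul_le_mul_of_nonneg_right (mul_le_mul_of_nonneg_right hCle
      (mul_nonneg (mul_nonneg (abs_nonneg _) ha0) (le_trans zero_le_one (le_max_left _ _))))
      (delta0_nonneg x)
  · exact div_le_div_of_nonneg_right (mul_le_mul_of_nonneg_right hCle hβ₁0) hj.le

/-- `b(z) ≤ t` in `d > 4` makes `G_z` square-summable (`Σ_x |x|^{-2(d-2)} < ∞`). This is the step
"`G_{z_c} ∈ ℓ²(ℤ^d)` … follows from `d > 4`, (2.18), and `G_{z_c}(0) < ∞`" of the proof of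
Theorem 1.7. [cite: LiuSlade2026, proof of Theorem 1.7] -/
theorem summable_sq_of_lsBootstrapLE (hd : 4 < d) {ε K_S : ℝ} {Gz : Site d → ℝ} {z t : ℝ}
    (h : LSBootstrapLE d L ε K_S Gz z t) (h0 : ∀ x, 0 ≤ Gz x) : Summable fun x => Gz x ^ 2 := by
  set c : ℝ := t * (K_S * (L : ℝ) ^ (-(2 - ε))) with hc
  have hs : (d : ℝ) < 2 * ((d : ℝ) - 2) := by
    have : (4 : ℝ) < d := by exact_mod_cast hd
    linarith
  have hmaj : Summable fun x : Site d => c ^ 2 * jnorm x ^ (-(2 * ((d : ℝ) - 2))) +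
      (if x = 0 then Gz 0 ^ 2 else 0) :=
    ((summable_jnorm_rpow_neg hs).mul_left _).add (summable_of_ne_finset_zero (s := {0})
      fun x hx => by rw [Finset.mem_singleton] at hx; rw [if_neg hx])
  refine hmaj.of_nonneg_of_le (fun x => sq_nonneg _) fun x => ?_
  by_cases hx : x = 0
  · subst hx
    simp only [if_true]
    have : 0 ≤ c ^ 2 * jnorm (0 : Site d) ^ (-(2 * ((d : ℝ) - 2))) :=
      mul_nonneg (sq_nonneg _) (Real.rpow_nonneg (jnorm_pos _).le _)
    linarith
  · rw [if_neg hx, add_zero]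
    have hx1 : 1 ≤ euclidNorm x := one_le_euclidNorm_of_ne_zero hx
    have hxpos : 0 < euclidNorm x := by linarith
    have hb : Gz x ≤ c * euclidNorm x ^ (-((d : ℝ) - 2)) := by
      have := h.1 x hx; rw [hc]; linarith [this]
    have hsq : Gz x ^ 2 ≤ (c * euclidNorm x ^ (-((d : ℝ) - 2))) ^ 2 :=
      pow_le_pow_left₀ (h0 x) hb 2
    refine hsq.trans (le_of_eq ?_)
    rw [mul_pow, jnorm_eq_euclidNorm hx1, ← Real.rpow_natCast (euclidNorm x ^ (-((d : ℝ) - 2))) 2,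
      ← Real.rpow_mul hxpos.le]
    congr 2
    push_cast; ring

/-- `⟦x⟧ → ∞` along the cofinite filter of `ℤ^d`. [folklore] -/
theorem tendsto_jnorm_cofinite : Tendsto (fun x : Site d => jnorm x) cofinite atTop := by
  have h1 : Tendsto (fun x : Site d => ‖x‖) cofinite atTop := by
    rw [← Filter.cocompact_eq_cofinite (Site d)]
    exact tendsto_norm_cocompact_atTop
  exact tendsto_atTop_mono (fun x => (norm_le_euclidNorm x).trans (euclidNorm_le_jnorm x)) h1

/-- **`S_1(x)|x|^{d-2} → a_d/σ²`** (`d > 2`, `L` large): from Prop. 1.2 (1.9) (at `ε = 1/2`) and the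
asymptotics (1.8) of `C_1` — the step "`S_1(x) ∼ σ^{-2}C_1(x) ∼ σ^{-2}a_d/|x|^{d-2}`" of (2.20).
[cite: LiuSlade2026, (2.20), Proposition 1.2 (1.9) and (1.8)] -/
theorem tendsto_soGreen_one_mul_rpow (h12 : LiuSlade2026_prop12_asymp) (h18 : srwGreen_asymp)
    (hd : 2 < d) :
    ∃ L₀ : ℕ, ∀ L : ℕ, L₀ ≤ L → 1 ≤ L →
      Tendsto (fun x : Site d => soGreen d L 1 x * euclidNorm x ^ ((d : ℝ) - 2)) cofinite
        (𝓝 (gaussianAmp d / soVariance d L)) := by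
  obtain ⟨C₉, L₀, h9⟩ := h12 d hd (1 / 2) one_half_pos
  obtain ⟨C₈, h8⟩ := h18 d hd
  refine ⟨L₀, fun L hL hL1 => ?_⟩
  have hd1 : 1 ≤ d := by omega
  have hσ1 : 1 ≤ soVariance d L := one_le_soVariance hd1 hL1
  have hσpos : 0 < soVariance d L := by linarith
  have hinv : Tendsto (fun x : Site d => jnorm x ^ (-(1 : ℝ))) cofinite (𝓝 0) :=
    (tendsto_rpow_neg_atTop one_pos).comp tendsto_jnorm_cofinite
  -- the bound `|S_1(x)|x|^{d-2} - a/σ²| ≤ (|C₉| + |C₈|) ⟦x⟧^{-1}` for `x ≠ 0`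
  set A : ℝ := |C₉| + |C₈| with hA
  have hbound : ∀ x : Site d, x ≠ 0 →
      |soGreen d L 1 x * euclidNorm x ^ ((d : ℝ) - 2) - gaussianAmp d / soVariance d L| ≤
        A * jnorm x ^ (-(1 : ℝ)) := by
    intro x hx
    have hx1 : 1 ≤ euclidNorm x := one_le_euclidNorm_of_ne_zero hx
    have hr : jnorm x = euclidNorm x := jnorm_eq_euclidNorm hx1
    have hrpos : 0 < euclidNorm x := by linarith
    have e9 := h9 L hL x
    have e8 := h8 x
    rw [delta0_of_ne_zero hx, sub_zero, hr] at e9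
    rw [hr] at e8
    have hσne : soVariance d L ≠ 0 := hσpos.ne'
    have hrd : euclidNorm x ^ ((d : ℝ) - 2) ≠ 0 := (Real.rpow_pos_of_pos hrpos _).ne'
    have hkey : soGreen d L 1 x * euclidNorm x ^ ((d : ℝ) - 2) - gaussianAmp d / soVariance d L =
        (soGreen d L 1 x - srwGreen d x / soVariance d L) * euclidNorm x ^ ((d : ℝ) - 2) +
          (srwGreen d x - gaussianAmp d / euclidNorm x ^ ((d : ℝ) - 2)) *
            euclidNorm x ^ ((d : ℝ) - 2) / soVariance d L := by
      field_simp
      ring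
    rw [hkey]
    have hr1' : euclidNorm x ^ (-(1 : ℝ)) = (euclidNorm x)⁻¹ := Real.rpow_neg_one _
    have hpow1 : euclidNorm x ^ ((d : ℝ) - 2) / euclidNorm x ^ ((d : ℝ) - 1) = (euclidNorm x)⁻¹ := by
      rw [← Real.rpow_sub hrpos, show (d : ℝ) - 2 - ((d : ℝ) - 1) = -1 by ring, hr1']
    have hpow2 : euclidNorm x ^ ((d : ℝ) - 2) / euclidNorm x ^ (d : ℝ) =
        (euclidNorm x)⁻¹ * (euclidNorm x)⁻¹ := by
      rw [← Real.rpow_sub hrpos, show (d : ℝ) - 2 - (d : ℝ) = -1 + -1 by ring,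
        Real.rpow_add hrpos, hr1']
    have hrinv1 : (euclidNorm x)⁻¹ ≤ 1 := inv_le_one_of_one_le₀ hx1
    have hrinv0 : 0 ≤ (euclidNorm x)⁻¹ := by positivity
    have hL12 : 1 ≤ (L : ℝ) ^ (1 - 1 / 2 : ℝ) := Real.one_le_rpow (by exact_mod_cast hL1) (by norm_num)
    have hT1 : |(soGreen d L 1 x - srwGreen d x / soVariance d L) * euclidNorm x ^ ((d : ℝ) - 2)| ≤
        |C₉| * (euclidNorm x)⁻¹ := by
      rw [abs_mul, abs_of_pos (Real.rpow_pos_of_pos hrpos _)]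
      calc |soGreen d L 1 x - srwGreen d x / soVariance d L| * euclidNorm x ^ ((d : ℝ) - 2)
          ≤ C₉ / ((L : ℝ) ^ (1 - 1 / 2 : ℝ) * euclidNorm x ^ ((d : ℝ) - 1)) *
              euclidNorm x ^ ((d : ℝ) - 2) :=
            mul_le_mul_of_nonneg_right e9 (Real.rpow_nonneg hrpos.le _)
        _ = C₉ / (L : ℝ) ^ (1 - 1 / 2 : ℝ) *
              (euclidNorm x ^ ((d : ℝ) - 2) / euclidNorm x ^ ((d : ℝ) - 1)) := by
            rw [div_mul_eq_div_div]; ring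
        _ ≤ |C₉| * (euclidNorm x)⁻¹ := by
            rw [hpow1]
            refine mul_le_mul_of_nonneg_right ?_ hrinv0
            calc C₉ / (L : ℝ) ^ (1 - 1 / 2 : ℝ) ≤ |C₉| / (L : ℝ) ^ (1 - 1 / 2 : ℝ) :=
                  div_le_div_of_nonneg_right (le_abs_self _) (by positivity)
              _ ≤ |C₉| / 1 := div_le_div_of_nonneg_left (abs_nonneg _) one_pos hL12
              _ = |C₉| := div_one _
    have hT2 : |(srwGreen d x - gaussianAmp d / euclidNorm x ^ ((d : ℝ) - 2)) *
        euclidNorm x ^ ((d : ℝ) - 2) / soVariance d L| ≤ |C₈| * (euclidNorm x)⁻¹ := by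
      rw [abs_div, abs_mul, abs_of_pos (Real.rpow_pos_of_pos hrpos _), abs_of_pos hσpos]
      calc |srwGreen d x - gaussianAmp d / euclidNorm x ^ ((d : ℝ) - 2)| *
            euclidNorm x ^ ((d : ℝ) - 2) / soVariance d L
          ≤ C₈ / euclidNorm x ^ (d : ℝ) * euclidNorm x ^ ((d : ℝ) - 2) / soVariance d L := by
            gcongr
        _ = C₈ / soVariance d L * (euclidNorm x ^ ((d : ℝ) - 2) / euclidNorm x ^ (d : ℝ)) := by
            ring
        _ ≤ |C₈| * (euclidNorm x)⁻¹ := by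
            rw [hpow2]
            have h1 : C₈ / soVariance d L ≤ |C₈| := by
              calc C₈ / soVariance d L ≤ |C₈| / soVariance d L :=
                    div_le_div_of_nonneg_right (le_abs_self _) hσpos.le
                _ ≤ |C₈| / 1 := div_le_div_of_nonneg_left (abs_nonneg _) one_pos hσ1
                _ = |C₈| := div_one _
            have h2 : (euclidNorm x)⁻¹ * (euclidNorm x)⁻¹ ≤ (euclidNorm x)⁻¹ := by
              calc (euclidNorm x)⁻¹ * (euclidNorm x)⁻¹ ≤ (euclidNorm x)⁻¹ * 1 :=
                    mul_le_mul_of_nonneg_left hrinv1 hrinv0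
                _ = _ := mul_one _
            have h1' : |C₈ / soVariance d L| ≤ |C₈| := by
              rw [abs_div, abs_of_pos hσpos]
              calc |C₈| / soVariance d L ≤ |C₈| / 1 :=
                    div_le_div_of_nonneg_left (abs_nonneg _) one_pos hσ1
                _ = |C₈| := div_one _
            calc C₈ / soVariance d L * ((euclidNorm x)⁻¹ * (euclidNorm x)⁻¹)
                ≤ |C₈ / soVariance d L| * ((euclidNorm x)⁻¹ * (euclidNorm x)⁻¹) :=
                  mul_le_mul_of_nonneg_right (le_abs_self _) (mul_nonneg hrinv0 hrinv0)
              _ ≤ |C₈| * (euclidNorm x)⁻¹ :=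
                  mul_le_mul h1' h2 (mul_nonneg hrinv0 hrinv0) (abs_nonneg _)
    calc _ ≤ |(soGreen d L 1 x - srwGreen d x / soVariance d L) * euclidNorm x ^ ((d : ℝ) - 2)| +
          |(srwGreen d x - gaussianAmp d / euclidNorm x ^ ((d : ℝ) - 2)) *
            euclidNorm x ^ ((d : ℝ) - 2) / soVariance d L| := abs_add_le _ _
      _ ≤ |C₉| * (euclidNorm x)⁻¹ + |C₈| * (euclidNorm x)⁻¹ := add_le_add hT1 hT2
      _ = A * jnorm x ^ (-(1 : ℝ)) := by rw [hr, hr1', hA]; ring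
  -- conclude by squeezing
  rw [tendsto_iff_norm_sub_tendsto_zero]
  refine squeeze_zero' (Filter.Eventually.of_forall fun x => norm_nonneg _)
    (g := fun x => A * jnorm x ^ (-(1 : ℝ))) ?_ ?_
  · filter_upwards [eventually_cofinite_ne (0 : Site d)] with x hx
    rw [Real.norm_eq_abs]; exact hbound x hx
  · simpa using hinv.const_mul A

/-- Each torus coordinate has norm at most `1/2`. [folklore] -/
theorem norm_coord_le_half (t : UnitAddTorus (Fin d)) (i : Fin d) : ‖t i‖ ≤ 1 / 2 := by
  have h := AddCircle.norm_le_half_period (1 : ℝ) (x := t i) one_ne_zero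
  simpa using h

/-- From `min(L²u, 1)` to `u`: `min (L² Σ_i ‖t_i‖²) 1 ≥ min (L², 4/d) · Σ_i ‖t_i‖²` (using
`Σ_i ‖t_i‖² ≤ d/4`). [folklore] -/
theorem min_mul_sum_sq_ge (hd : 1 ≤ d) (Lr : ℝ) (t : UnitAddTorus (Fin d)) :
    min (Lr ^ 2) (4 / d) * ∑ i, ‖t i‖ ^ 2 ≤ min (Lr ^ 2 * ∑ i, ‖t i‖ ^ 2) 1 := by
  set u : ℝ := ∑ i, ‖t i‖ ^ 2 with hu
  have hu0 : 0 ≤ u := Finset.sum_nonneg fun i _ => sq_nonneg _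
  have hdpos : (0 : ℝ) < d := by exact_mod_cast hd
  have hud : u ≤ d / 4 := by
    calc u ≤ ∑ _i : Fin d, (1 / 2 : ℝ) ^ 2 :=
          Finset.sum_le_sum fun i _ => pow_le_pow_left₀ (norm_nonneg _) (norm_coord_le_half t i) 2
      _ = d / 4 := by
          rw [Finset.sum_const, Finset.card_univ, Fintype.card_fin, nsmul_eq_mul]; ring
  rcases le_or_gt (Lr ^ 2 * u) 1 with h | h
  · rw [min_eq_left h]
    exact mul_le_mul_of_nonneg_right (min_le_left _ _) hu0
  · rw [min_eq_right h.le]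
    calc min (Lr ^ 2) (4 / d) * u ≤ 4 / d * u := mul_le_mul_of_nonneg_right (min_le_right _ _) hu0
      _ ≤ 4 / d * (d / 4) := mul_le_mul_of_nonneg_left hud (by positivity)
      _ = 1 := by field_simp

/-! ### The analytic inputs at one spread-out level `L` (packaged) -/

/-- Theorem 2.2 at level `L` with constants `β⋆, c, C` (the inner statement of
`LiuSlade2026_thm22`). [cite: LiuSlade2026, Theorem 2.2] -/
def Thm22At (d L : ℕ) (ρ βs c C : ℝ) : Prop :=
  ∀ (z β₀ β₁ : ℝ) (Pz : Site d → ℝ), 0 ≤ β₀ → 0 ≤ β₁ → max β₀ β₁ ≤ βs →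
    LSAssumptionF d L ρ β₀ β₁ z Pz →
      Integrable (fun t : UnitAddTorus (Fin d) => (latticeFourier (lsF d L z Pz) t)⁻¹) ∧
      |fourierInverseG (lsF d L z Pz) 0 -
          lsLambda d L (lsF d L z Pz) * soGreen d L (lsMu d L (lsF d L z Pz)) 0| ≤
        C * max β₀ β₁ ∧
      (∀ x : Site d, x ≠ 0 →
        |fourierInverseG (lsF d L z Pz) x -
            lsLambda d L (lsF d L z Pz) * soGreen d L (lsMu d L (lsF d L z Pz)) x| ≤
          C * (max β₀ β₁ * ((L : ℝ) ^ (-c) + max β₀ β₁) + β₁) / euclidNorm x ^ lsND d ρ) ∧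
      Tendsto (fun x : Site d =>
          (fourierInverseG (lsF d L z Pz) x -
              lsLambda d L (lsF d L z Pz) * soGreen d L (lsMu d L (lsF d L z Pz)) x) *
            euclidNorm x ^ lsND d ρ) cofinite (𝓝 0)

/-- The infrared bound (2.3) at level `L` with constants `β⋆, K` (the inner statement of
`LiuSlade2026_infraredBound`). [cite: LiuSlade2026, (2.3)] -/
def IRAt (d L : ℕ) (ρ βs K : ℝ) : Prop :=
  ∀ (z β₀ β₁ : ℝ) (Pz : Site d → ℝ), 0 ≤ β₀ → 0 ≤ β₁ → max β₀ β₁ ≤ βs → 1 ≤ z →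
    IsZdSymmetric Pz →
    (∀ x : Site d, |Pz x| ≤ β₀ * delta0 x + β₁ / jnorm x ^ ((d : ℝ) + 2 + ρ)) →
    ∀ t : UnitAddTorus (Fin d),
      K * min ((L : ℝ) ^ 2 * ∑ i, ‖t i‖ ^ 2) 1 ≤
        (latticeFourier (lsF d L z Pz) t).re - (latticeFourier (lsF d L z Pz) 0).re

/-- The estimates (2.5)–(2.6) at level `L` with constant `K` (the inner statement of
`exists_lsLambda_estimates`). [cite: LiuSlade2026, (2.5)–(2.6)] -/
def EstimatesAt (d L : ℕ) (ρ K : ℝ) : Prop :=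
  ∀ (β₀ β₁ z : ℝ) (P : Site d → ℝ), 0 ≤ β₀ → 0 ≤ β₁ →
    K * max β₀ β₁ ≤ 1 / 2 → LSAssumptionF d L ρ β₀ β₁ z P →
      z ≤ 1 + K * max β₀ β₁ ∧
      (0 ≤ ∑' x, lsF d L z P x ∧ ∑' x, lsF d L z P x ≤ K * max β₀ β₁) ∧
      |∑' x, P x| ≤ K * max β₀ β₁ ∧
      |∑' x, euclidNorm x ^ 2 * P x| ≤ K * β₁ ∧
      (0 < lsLambda d L (lsF d L z P) ∧ lsLambda d L (lsF d L z P) ≤ 2 ∧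
        |lsLambda d L (lsF d L z P) - 1| ≤ 2 * K * max β₀ β₁) ∧
      (0 ≤ lsMu d L (lsF d L z P) ∧ lsMu d L (lsF d L z P) ≤ 1 ∧
        1 - lsMu d L (lsF d L z P) ≤ 2 * K * max β₀ β₁)

/-- Proposition 1.6 at level `L` for the family `G` (the inner statement of
`exists_impulse_of_assumptionH`). [cite: LiuSlade2026, Proposition 1.6] -/
def ImpulseAt (d L : ℕ) (ρ ε K_S K_h ηL zc : ℝ) (G : ℝ → Site d → ℝ) (βs C : ℝ) : Prop :=
  ∀ z : ℝ, |K_h| * (L : ℝ) ^ (-(2 - ε)) * max 1 |ηL| ≤ βs →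
    LSAssumptionH d L ε K_S ρ K_h ηL G zc → z ∈ Set.Icc 1 zc →
    LSBootstrapLE d L ε K_S (G z) z 3 → (∃ M : ℝ, ∀ x, |G z x| ≤ M) →
    ∃ Φ : Site d → ℝ, IsZdSymmetric Φ ∧
      (∀ x, |Φ x| ≤ C * (|K_h| * (L : ℝ) ^ (-(2 - ε)) * max 1 |ηL|) * delta0 x +
        C * (|K_h| * (L : ℝ) ^ (-(2 - ε)) * |ηL|) / jnorm x ^ ((d : ℝ) + 2 + ρ)) ∧
      ∀ x, latticeConv (lsF d L z Φ) (G z) x = delta0 x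

/-- `|x|^{-(d-2)} ≥ 1/|x|^{n_d}` for `x ≠ 0` (`n_d ≥ d - 2`, `|x| ≥ 1`; `d ≥ 2`). [cite: LiuSlade2026, (2.7)] -/
theorem inv_pow_lsND_le_rpow (hd : 2 ≤ d) (ρ : ℝ) {x : Site d} (hx : x ≠ 0) :
    1 / euclidNorm x ^ lsND d ρ ≤ euclidNorm x ^ (-((d : ℝ) - 2)) := by
  have hx1 : 1 ≤ euclidNorm x := one_le_euclidNorm_of_ne_zero hx
  have hxpos : 0 < euclidNorm x := by linarith
  have hcast : ((d : ℝ) - 2) = ((d - 2 : ℕ) : ℝ) := by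
    rw [Nat.cast_sub hd]; norm_num
  rw [Real.rpow_neg hxpos.le, hcast, Real.rpow_natCast, one_div]
  exact inv_anti₀ (pow_pos hxpos _) (pow_le_pow_right₀ hx1 (sub_two_le_lsND d ρ))

/-- **Proposition 2.3 (bootstrap), the implication `b(z) ≤ 3 ⇒ b(z) ≤ 2` for `z < z_c`**, at a
level `L` at which the inputs hold and the `L`-dependent small quantities are small: with
`β = C₄|K_h|L^{-(2-ε)}` (`|o(1)| ≤ 1`), `F_z * G_z = δ` (Prop. 1.6), `F̂_z(0) = 1/Σ_xG_z(x) ≥ 0`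
((2.14)), `G_z = 𝒢_z` (Fourier inversion on `ℓ¹`), Theorem 2.2, `λ_z = 1 + O(β)`,
`S_{μ_z} ≤ S_1 ≤ K_S/(L^{2-ε}|x|^{d-2})` ((2.16)), give
`G_z(x) ≤ [(1 + 2Kβ)K_S + |C₂|C₄|K_h|(L^{-c} + β + |o(1)|)] L^{-(2-ε)}|x|^{-(d-2)} ≤ 2K_S L^{-(2-ε)}|x|^{-(d-2)}`
((2.17)) and `3(z - 1) ≤ 3Kβ ≤ 3/2`. [cite: LiuSlade2026, Proposition 2.3 and its proof, (2.14)–(2.17)] -/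
theorem bootstrap_implication (hd : 4 < d) (hL1 : 1 ≤ L) {ρ ε K_S K_h ηL zc : ℝ}
    {G : ℝ → Site d → ℝ} (hρ : 0 < ρ) (hKS : 0 < K_S)
    (hA : LSAssumptionG d L G zc) (hH : LSAssumptionH d L ε K_S ρ K_h ηL G zc)
    (hS : ∀ x : Site d, soGreen d L 1 x ≤
      delta0 x + K_S * (L : ℝ) ^ (-(2 - ε)) * jnorm x ^ (-((d : ℝ) - 2)))
    {βs₄ C₄ : ℝ} (hC₄ : 0 ≤ C₄) (H4 : ImpulseAt d L ρ ε K_S K_h ηL zc G βs₄ C₄)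
    (hsmall4 : |K_h| * (L : ℝ) ^ (-(2 - ε)) * max 1 |ηL| ≤ βs₄) (hη1 : |ηL| ≤ 1)
    {βs₂ c C₂ : ℝ} (H22 : Thm22At d L ρ βs₂ c C₂)
    (hsmall2 : C₄ * |K_h| * (L : ℝ) ^ (-(2 - ε)) ≤ βs₂)
    {K : ℝ} (hK : 0 < K) (HE : EstimatesAt d L ρ K)
    (hsmallE : K * (C₄ * |K_h| * (L : ℝ) ^ (-(2 - ε))) ≤ 1 / 2)
    (hboot : 2 * K * (C₄ * |K_h|) * K_S * (L : ℝ) ^ (-(2 - ε)) +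
      |C₂| * (C₄ * |K_h|) * ((L : ℝ) ^ (-c) + C₄ * |K_h| * (L : ℝ) ^ (-(2 - ε)) + |ηL|) ≤ K_S) :
    ∀ z ∈ Set.Ico 1 zc, LSBootstrapLE d L ε K_S (G z) z 3 → LSBootstrapLE d L ε K_S (G z) z 2 := by
  intro z hz hb3
  have hd2 : 2 ≤ d := by omega
  have hd3 : 3 ≤ d := by omega
  have hz' : z ∈ Set.Icc 1 zc := ⟨hz.1, hz.2.le⟩
  have hLpos : (0 : ℝ) < L := by exact_mod_cast hL1
  -- the small parameters
  set a : ℝ := (L : ℝ) ^ (-(2 - ε)) with ha_def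
  have ha : 0 < a := Real.rpow_pos_of_pos hLpos _
  set A : ℝ := C₄ * |K_h| with hA_def
  have hA0 : 0 ≤ A := mul_nonneg hC₄ (abs_nonneg _)
  have hmax1 : max 1 |ηL| = 1 := max_eq_left hη1
  set β₀ : ℝ := C₄ * (|K_h| * a * max 1 |ηL|) with hβ₀_def
  set β₁ : ℝ := C₄ * (|K_h| * a * |ηL|) with hβ₁_def
  have hβ₀ : β₀ = A * a := by rw [hβ₀_def, hmax1, hA_def]; ring
  have hβ₁ : β₁ = A * a * |ηL| := by rw [hβ₁_def, hA_def]; ring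
  have hβ₀0 : 0 ≤ β₀ := by rw [hβ₀]; positivity
  have hβ₁0 : 0 ≤ β₁ := by rw [hβ₁]; positivity
  have hβ₁le : β₁ ≤ β₀ := by
    rw [hβ₀, hβ₁]
    calc A * a * |ηL| ≤ A * a * 1 := mul_le_mul_of_nonneg_left hη1 (by positivity)
      _ = A * a := mul_one _
  have hmax : max β₀ β₁ = A * a := by rw [max_eq_left hβ₁le, hβ₀]
  -- nonnegativity, boundedness, summability of `G_z`
  have hG0 : ∀ x, 0 ≤ G z x := hA.nonneg z hz'
  have hbdd : ∃ M : ℝ, ∀ x, |G z x| ≤ M :=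
    exists_bound_of_lsBootstrapLE hd2 hKS.le (by norm_num) hb3 hG0
  have hGs : Summable (G z) := hA.summable_subcrit z hz
  have hGabs : Summable fun x => |G z x| := hGs.congr fun x => (abs_of_nonneg (hG0 x)).symm
  -- Prop. 1.6: the impulse equation
  obtain ⟨Φ, hΦs, hΦb, hconv⟩ := H4 z hsmall4 hH hz' hb3 hbdd
  have hΦb' : ∀ x, |Φ x| ≤ β₀ * delta0 x + β₁ / jnorm x ^ ((d : ℝ) + 2 + ρ) := hΦb
  have hsd : (d : ℝ) < (d : ℝ) + 2 + ρ := by linarith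
  have hΦabs : Summable fun x => |Φ x| := summable_abs_of_lsBound hβ₀0 hΦb' hsd
  have hF : Summable fun x => |lsF d L z Φ x| := summable_abs_lsF z hΦabs
  -- (2.14): `F̂_z(0) Ĝ_z(0) = 1`, so `F̂_z(0) ≥ 0`
  have hprod := tsum_mul_tsum_eq_one hF hGabs hconv
  have hF0 : 0 ≤ ∑' x, lsF d L z Φ x := by
    by_contra hneg
    rw [not_le] at hneg
    have hGsum : 0 ≤ ∑' x, G z x := tsum_nonneg hG0
    have : (∑' x, lsF d L z Φ x) * ∑' x, G z x ≤ 0 := mul_nonpos_of_nonpos_of_nonneg hneg.le hGsum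
    linarith
  have hAF : LSAssumptionF d L ρ β₀ β₁ z Φ := ⟨hz.1, hΦs, hΦb', hF0⟩
  -- Theorem 2.2 and the estimates
  obtain ⟨_, _, hxbd, _⟩ := H22 z β₀ β₁ Φ hβ₀0 hβ₁0 (by rw [hmax]; exact hsmall2) hAF
  obtain ⟨hzle, _, _, _, ⟨hlampos, _, hlam1⟩, ⟨hμ0, hμ1, _⟩⟩ :=
    HE β₀ β₁ z Φ hβ₀0 hβ₁0 (by rw [hmax]; exact hsmallE) hAF
  rw [hmax] at hzle hlam1 hxbd
  -- `G_z = 𝒢_z`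
  have hGeq : ∀ x, G z x = fourierInverseG (lsF d L z Φ) x := fun x =>
    eq_fourierInverseG hF hGabs hconv x
  refine ⟨fun x hx => ?_, by nlinarith [hzle, hsmallE, hK]⟩
  -- the main bound at `x ≠ 0`
  have hx1 : 1 ≤ euclidNorm x := one_le_euclidNorm_of_ne_zero hx
  have hxpos : 0 < euclidNorm x := by linarith
  set w : ℝ := euclidNorm x ^ (-((d : ℝ) - 2)) with hw_def
  have hw0 : 0 < w := Real.rpow_pos_of_pos hxpos _
  set lam : ℝ := lsLambda d L (lsF d L z Φ) with hlam_def
  set μ : ℝ := lsMu d L (lsF d L z Φ) with hμ_def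
  have hlamle : lam ≤ 1 + 2 * K * (A * a) := by
    have := (abs_le.1 hlam1).2; linarith
  -- `S_μ ≤ S_1 ≤ K_S a w`
  have hSμ : soGreen d L μ x ≤ K_S * a * w := by
    refine (soGreen_le_soGreen_one hμ0 hμ1 (summable_convPow hd3 hL1 x)).trans ?_
    have := hS x
    rwa [delta0_of_ne_zero hx, zero_add, jnorm_eq_euclidNorm hx1] at this
  have hSμ0 : 0 ≤ soGreen d L μ x := soGreen_nonneg hμ0 x
  -- the error term
  have herr : fourierInverseG (lsF d L z Φ) x - lam * soGreen d L μ x ≤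
      |C₂| * (A * a * ((L : ℝ) ^ (-c) + A * a) + β₁) * w := by
    have h1 := hxbd x hx
    have hX : 0 ≤ A * a * ((L : ℝ) ^ (-c) + A * a) + β₁ := by positivity
    calc fourierInverseG (lsF d L z Φ) x - lam * soGreen d L μ x
        ≤ |fourierInverseG (lsF d L z Φ) x - lam * soGreen d L μ x| := le_abs_self _
      _ ≤ C₂ * (A * a * ((L : ℝ) ^ (-c) + A * a) + β₁) / euclidNorm x ^ lsND d ρ := h1
      _ = C₂ * (A * a * ((L : ℝ) ^ (-c) + A * a) + β₁) * (1 / euclidNorm x ^ lsND d ρ) := by ring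
      _ ≤ |C₂| * (A * a * ((L : ℝ) ^ (-c) + A * a) + β₁) * w := by
          refine mul_le_mul ?_ (inv_pow_lsND_le_rpow hd2 ρ hx) (by positivity) (by positivity)
          exact mul_le_mul_of_nonneg_right (le_abs_self _) hX
  -- assemble (2.17)
  have hmain : G z x ≤ ((1 + 2 * K * (A * a)) * K_S +
      |C₂| * A * ((L : ℝ) ^ (-c) + A * a + |ηL|)) * (a * w) := by
    have h1 : lam * soGreen d L μ x ≤ (1 + 2 * K * (A * a)) * (K_S * a * w) :=
      mul_le_mul hlamle hSμ hSμ0 (by positivity)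
    have h2 : |C₂| * (A * a * ((L : ℝ) ^ (-c) + A * a) + β₁) * w =
        |C₂| * A * ((L : ℝ) ^ (-c) + A * a + |ηL|) * (a * w) := by rw [hβ₁]; ring
    calc G z x = lam * soGreen d L μ x + (fourierInverseG (lsF d L z Φ) x - lam * soGreen d L μ x) := by
          rw [hGeq x]; ring
      _ ≤ (1 + 2 * K * (A * a)) * (K_S * a * w) + |C₂| * A * ((L : ℝ) ^ (-c) + A * a + |ηL|) * (a * w) :=
          add_le_add h1 (h2 ▸ herr)
      _ = _ := by ring
  have hcoef : (1 + 2 * K * (A * a)) * K_S + |C₂| * A * ((L : ℝ) ^ (-c) + A * a + |ηL|) ≤ 2 * K_S := by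
    linarith [hboot]
  calc G z x ≤ ((1 + 2 * K * (A * a)) * K_S + |C₂| * A * ((L : ℝ) ^ (-c) + A * a + |ηL|)) * (a * w) := hmain
    _ ≤ 2 * K_S * (a * w) := mul_le_mul_of_nonneg_right hcoef (by positivity)
    _ = 2 * (K_S * a * w) := by ring

/-- **Theorem 1.7 at one level `L`** (the conclusion of the proof of Thm. 1.7, §2.2, given the
inputs at level `L` and the smallness of the `L`-dependent quantities): the bootstrap
(`bootstrap_implication`, `forall_lsBootstrapLE_two`) gives `b ≤ 2` on `[1, z_c]`; at `z_c`,
Prop. 1.6 gives `F_{z_c} * G_{z_c} = δ` with `G_{z_c} ∈ ℓ²` (`d > 4`), whence `F̂_{z_c}(0) = 0`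
(`tsum_eq_zero_of_latticeConv_eq_delta0`, using the infrared bound), Assumption 2.1 at `z_c` with
`μ_{z_c} = 1`, `G_{z_c} = 𝒢_{z_c}` (the `L²` Fourier transform), and Theorem 2.2 with
`S_1(x)|x|^{d-2} → a_d/σ²` give (1.20) with `λ_{z_c} = 1 + O(L^{-(2-ε)})`; Liu–Slade 2024,
Thm. 1.2 gives (1.21), the constant `a_d/F''` being `λ_{z_c}a_d/σ²` by (2.6).
[cite: LiuSlade2026, proof of Theorem 1.7 (§2.2), (2.18)–(2.20) and (1.21)] -/
theorem thm1_7_at_level (hd : 4 < d) (hL1 : 1 ≤ L) {ρ ε K_S K_h ηL zc : ℝ}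
    {G : ℝ → Site d → ℝ} (hρ : max (((d : ℝ) - 8) / 2) 0 < ρ) (hKS : 0 < K_S)
    (hA : LSAssumptionG d L G zc) (hH : LSAssumptionH d L ε K_S ρ K_h ηL G zc)
    (hS : ∀ x : Site d, soGreen d L 1 x ≤
      delta0 x + K_S * (L : ℝ) ^ (-(2 - ε)) * jnorm x ^ (-((d : ℝ) - 2)))
    {βs₄ C₄ : ℝ} (hC₄ : 0 ≤ C₄) (H4 : ImpulseAt d L ρ ε K_S K_h ηL zc G βs₄ C₄)
    (hsmall4 : |K_h| * (L : ℝ) ^ (-(2 - ε)) * max 1 |ηL| ≤ βs₄) (hη1 : |ηL| ≤ 1)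
    {βs₂ c C₂ : ℝ} (H22 : Thm22At d L ρ βs₂ c C₂)
    (hsmall2 : C₄ * |K_h| * (L : ℝ) ^ (-(2 - ε)) ≤ βs₂)
    {K : ℝ} (hK : 0 < K) (HE : EstimatesAt d L ρ K)
    (hsmallE : K * (C₄ * |K_h| * (L : ℝ) ^ (-(2 - ε))) ≤ 1 / 2)
    (hboot : 2 * K * (C₄ * |K_h|) * K_S * (L : ℝ) ^ (-(2 - ε)) +
      |C₂| * (C₄ * |K_h|) * ((L : ℝ) ^ (-c) + C₄ * |K_h| * (L : ℝ) ^ (-(2 - ε)) + |ηL|) ≤ K_S)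
    {βsI K_I : ℝ} (hKI : 0 < K_I) (HIR : IRAt d L ρ βsI K_I)
    (hsmallI : C₄ * |K_h| * (L : ℝ) ^ (-(2 - ε)) ≤ βsI)
    (h24 : LiuSlade2024_thm12_critical)
    (hS1 : Tendsto (fun x : Site d => soGreen d L 1 x * euclidNorm x ^ ((d : ℝ) - 2)) cofinite
      (𝓝 (gaussianAmp d / soVariance d L))) :
    ∃ lamL : ℝ,
      |lamL - 1| ≤ 2 * K * (C₄ * |K_h|) * (L : ℝ) ^ (-(2 - ε)) ∧
      Tendsto (fun x : Site d => G zc x * euclidNorm x ^ ((d : ℝ) - 2)) cofinite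
        (𝓝 (lamL * gaussianAmp d / soVariance d L)) ∧
      ∀ s : ℝ, s < min (min ρ 2) (ρ - ((d : ℝ) - 8) / 2) → ∃ Kc : ℝ, ∀ x : Site d,
        |G zc x - lamL * gaussianAmp d / (soVariance d L * jnorm x ^ ((d : ℝ) - 2))| ≤
          Kc / jnorm x ^ ((d : ℝ) - 2 + s) := by
  have hρ0 : 0 < ρ := lt_of_le_of_lt (le_max_right _ _) hρ
  have hd1 : 1 ≤ d := by omega
  have hd2 : 2 ≤ d := by omega
  have hd2' : 2 < d := by omega
  have hd3 : 3 ≤ d := by omega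
  have hLpos : (0 : ℝ) < L := by exact_mod_cast hL1
  have hσ1 : 1 ≤ soVariance d L := one_le_soVariance hd1 hL1
  have hσpos : 0 < soVariance d L := by linarith
  -- the small parameters
  set a : ℝ := (L : ℝ) ^ (-(2 - ε)) with ha_def
  have ha : 0 < a := Real.rpow_pos_of_pos hLpos _
  set A : ℝ := C₄ * |K_h| with hA_def
  have hA0 : 0 ≤ A := mul_nonneg hC₄ (abs_nonneg _)
  have hmax1 : max 1 |ηL| = 1 := max_eq_left hη1
  -- Step 1: `b ≤ 2` on `[1, z_c]`
  have hstep := bootstrap_implication hd hL1 hρ0 hKS hA hH hS hC₄ H4 hsmall4 hη1 H22 hsmall2 hK HE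
    hsmallE hboot
  have hb1 : LSBootstrapLE d L ε K_S (G 1) 1 2 :=
    (lsBootstrapLE_one_of_le_green hA hS).mono (by norm_num) hKS.le
  have hall := forall_lsBootstrapLE_two hA hKS hL1 hb1 hstep
  have hzc1 : 1 ≤ zc := hA.one_le_zc
  have hzcI : zc ∈ Set.Icc 1 zc := ⟨hzc1, le_rfl⟩
  have hbc2 : LSBootstrapLE d L ε K_S (G zc) zc 2 := hall zc hzcI
  have hbc3 : LSBootstrapLE d L ε K_S (G zc) zc 3 := hbc2.mono (by norm_num) hKS.le
  -- Step 2: the impulse equation at `z_c`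
  have hG0 : ∀ x, 0 ≤ G zc x := hA.nonneg zc hzcI
  have hbdd : ∃ M : ℝ, ∀ x, |G zc x| ≤ M :=
    exists_bound_of_lsBootstrapLE hd2 hKS.le (by norm_num) hbc3 hG0
  obtain ⟨Φ, hΦs, hΦb, hconv⟩ := H4 zc hsmall4 hH hzcI hbc3 hbdd
  set β₀ : ℝ := C₄ * (|K_h| * a * max 1 |ηL|) with hβ₀_def
  set β₁ : ℝ := C₄ * (|K_h| * a * |ηL|) with hβ₁_def
  have hβ₀ : β₀ = A * a := by rw [hβ₀_def, hmax1, hA_def]; ring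
  have hβ₁ : β₁ = A * a * |ηL| := by rw [hβ₁_def, hA_def]; ring
  have hβ₀0 : 0 ≤ β₀ := by rw [hβ₀]; positivity
  have hβ₁0 : 0 ≤ β₁ := by rw [hβ₁]; positivity
  have hβ₁le : β₁ ≤ β₀ := by
    rw [hβ₀, hβ₁]
    calc A * a * |ηL| ≤ A * a * 1 := mul_le_mul_of_nonneg_left hη1 (by positivity)
      _ = A * a := mul_one _
  have hmax : max β₀ β₁ = A * a := by rw [max_eq_left hβ₁le, hβ₀]
  have hΦb' : ∀ x, |Φ x| ≤ β₀ * delta0 x + β₁ / jnorm x ^ ((d : ℝ) + 2 + ρ) := hΦb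
  have hsd : (d : ℝ) < (d : ℝ) + 2 + ρ := by linarith
  have hsd2 : (d : ℝ) < (d : ℝ) + 2 + ρ - 2 := by linarith
  have hΦabs : Summable fun x => |Φ x| := summable_abs_of_lsBound hβ₀0 hΦb' hsd
  have hΦ2 : Summable fun x => euclidNorm x ^ 2 * Φ x := summable_sq_mul_of_lsBound hβ₀0 hΦb' hsd2
  set Fc : Site d → ℝ := lsF d L zc Φ with hFc_def
  have hF : Summable fun x => |Fc x| := summable_abs_lsF zc hΦabs
  have hFsymm : IsZdSymmetric Fc := isZdSymmetric_lsF zc hΦs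
  -- `G_{z_c} ∈ ℓ² \ ℓ¹`, with the bootstrap decay `G_{z_c}(x) ≤ C⟦x⟧^{-(d-2)}`
  have hG2 : Summable fun x => G zc x ^ 2 := summable_sq_of_lsBootstrapLE hd hbc2 hG0
  have hGns : ¬Summable (G zc) := hA.not_summable_crit
  have hGle : ∀ x, G zc x ≤ max (G zc 0) (2 * (K_S * (L : ℝ) ^ (-(2 - ε)))) *
      jnorm x ^ (-((d : ℝ) - 2)) := by
    intro x
    by_cases hx : x = 0
    · subst hx
      rw [jnorm_zero, Real.one_rpow, mul_one]
      exact le_max_left _ _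
    · have hx1 : 1 ≤ euclidNorm x := one_le_euclidNorm_of_ne_zero hx
      have h := hbc2.1 x hx
      rw [jnorm_eq_euclidNorm hx1]
      calc G zc x ≤ 2 * (K_S * (L : ℝ) ^ (-(2 - ε)) * euclidNorm x ^ (-((d : ℝ) - 2))) := h
        _ = 2 * (K_S * (L : ℝ) ^ (-(2 - ε))) * euclidNorm x ^ (-((d : ℝ) - 2)) := by ring
        _ ≤ _ := mul_le_mul_of_nonneg_right (le_max_right _ _)
            (Real.rpow_nonneg (euclidNorm_nonneg x) _)
  -- the second absolute moment of `F_{z_c}`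
  have hΦ2abs : Summable fun x => euclidNorm x ^ 2 * |Φ x| :=
    summable_sq_mul_abs_of_lsBound hβ₀0 hΦb' hsd2
  have hF2 : Summable fun x => euclidNorm x ^ 2 * |Fc x| := summable_sq_mul_abs_lsF zc hΦ2abs
  -- the infrared bound at `z_c` (used for (1.21))
  have hIR := HIR zc β₀ β₁ Φ hβ₀0 hβ₁0 (by rw [hmax]; exact hsmallI) hzc1 hΦs hΦb'
  -- Step 3: `F̂_{z_c}(0) = 0` (the tree's `x`-space criticality theorem)
  have hF0 : ∑' x, Fc x = 0 :=
    tsum_eq_zero_of_latticeConv_eq_delta0 hd2 hF hF2 hG0 hGle hGns hconv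
  have hAF : LSAssumptionF d L ρ β₀ β₁ zc Φ := ⟨hzc1, hΦs, hΦb', by rw [← hFc_def, hF0]⟩
  -- Step 4: Theorem 2.2 and the estimates at `z_c`
  obtain ⟨_, _, _, htend⟩ := H22 zc β₀ β₁ Φ hβ₀0 hβ₁0 (by rw [hmax]; exact hsmall2) hAF
  obtain ⟨_, _, _, hS2bd, ⟨hlampos, _, hlam1⟩, _⟩ :=
    HE β₀ β₁ zc Φ hβ₀0 hβ₁0 (by rw [hmax]; exact hsmallE) hAF
  rw [hmax] at hlam1
  set lam : ℝ := lsLambda d L Fc with hlam_def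
  have hμ1 : lsMu d L Fc = 1 := lsMu_eq_one_of_tsum_eq_zero hF0
  have hGeq : ∀ x, G zc x = fourierInverseG Fc x := fun x =>
    eq_fourierInverseG_of_summable_sq hF hG2 hconv x
  -- `-Σ|x|²F_{z_c}(x) = σ²/λ_{z_c}` ((2.6) with `F̂_{z_c}(0) = 0`)
  have hFpp : -(∑' y, euclidNorm y ^ 2 * Fc y) = soVariance d L / lam := by
    have h1 : lam = ((∑' x, Fc x) + zc + (soVariance d L)⁻¹ * ∑' x, euclidNorm x ^ 2 * Φ x)⁻¹ :=
      lsLambda_lsF_eq hd1 hL1 zc hΦ2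
    have h2 : ∑' y, euclidNorm y ^ 2 * Fc y = -(zc * soVariance d L) - ∑' x, euclidNorm x ^ 2 * Φ x :=
      (hasSum_sq_mul_lsF zc hΦ2).tsum_eq
    rw [hF0, zero_add] at h1
    have hden : zc + (soVariance d L)⁻¹ * ∑' x, euclidNorm x ^ 2 * Φ x ≠ 0 := by
      intro h0; rw [h0, inv_zero] at h1; rw [h1] at hlampos; exact lt_irrefl _ hlampos
    rw [h2, h1, div_inv_eq_mul]
    field_simp
    ring
  have hlam1' : |lam - 1| ≤ 2 * K * A * a := by
    calc |lam - 1| ≤ 2 * K * (A * a) := hlam1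
      _ = 2 * K * A * a := by ring
  refine ⟨lam, hlam1', ?_, ?_⟩
  · -- (1.20): `G_{z_c}(x)|x|^{d-2} → λ a_d/σ²`
    have htend' : Tendsto (fun x : Site d =>
        (fourierInverseG Fc x - lam * soGreen d L 1 x) * euclidNorm x ^ lsND d ρ) cofinite (𝓝 0) := by
      rw [← hμ1]; exact htend
    -- the error term tends to `0` after multiplying by `|x|^{d-2} ≤ |x|^{n_d}`
    have herr : Tendsto (fun x : Site d =>
        (fourierInverseG Fc x - lam * soGreen d L 1 x) * euclidNorm x ^ ((d : ℝ) - 2)) cofinite (𝓝 0) := by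
      refine squeeze_zero_norm' ?_ (tendsto_zero_iff_norm_tendsto_zero.1 htend')
      filter_upwards [eventually_cofinite_ne (0 : Site d)] with x hx
      have hx1 : 1 ≤ euclidNorm x := one_le_euclidNorm_of_ne_zero hx
      have hxpos : 0 < euclidNorm x := by linarith
      rw [norm_mul, norm_mul, Real.norm_of_nonneg (Real.rpow_nonneg hxpos.le _),
        Real.norm_of_nonneg (pow_nonneg hxpos.le _)]
      refine mul_le_mul_of_nonneg_left ?_ (norm_nonneg _)
      have hcast : ((d : ℝ) - 2) = ((d - 2 : ℕ) : ℝ) := by rw [Nat.cast_sub hd2]; norm_num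
      rw [hcast, Real.rpow_natCast]
      exact pow_le_pow_right₀ hx1 (sub_two_le_lsND d ρ)
    have hmainT : Tendsto (fun x : Site d => lam * (soGreen d L 1 x * euclidNorm x ^ ((d : ℝ) - 2)) +
        (fourierInverseG Fc x - lam * soGreen d L 1 x) * euclidNorm x ^ ((d : ℝ) - 2)) cofinite
        (𝓝 (lam * (gaussianAmp d / soVariance d L) + 0)) := (hS1.const_mul lam).add herr
    rw [add_zero, ← mul_div_assoc] at hmainT
    refine hmainT.congr fun x => ?_
    rw [hGeq x]; ring
  · -- (1.21) from Liu–Slade 2024, Thm. 1.2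
    intro s hs
    obtain ⟨K₁, hK₁, hFdec⟩ := exists_lsF_le_div_jnorm (d := d) (L := L) zc hβ₀0 hΦb'
    set K₂ : ℝ := K_I * min ((L : ℝ) ^ 2) (4 / d) with hK₂_def
    have hK₂ : 0 < K₂ := mul_pos hKI (lt_min (by positivity) (by positivity))
    have hIR2 : ∀ t : UnitAddTorus (Fin d), K₂ * ∑ i, ‖t i‖ ^ 2 ≤ (latticeFourier Fc t).re := by
      intro t
      have h : K_I * min ((L : ℝ) ^ 2 * ∑ i, ‖t i‖ ^ 2) 1 ≤
          (latticeFourier Fc t).re - (latticeFourier Fc 0).re := hIR t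
      have h0 : (latticeFourier Fc 0).re = 0 := by
        rw [latticeFourier_zero, Complex.ofReal_re, hF0]
      rw [h0, sub_zero] at h
      calc K₂ * ∑ i, ‖t i‖ ^ 2 = K_I * (min ((L : ℝ) ^ 2) (4 / d) * ∑ i, ‖t i‖ ^ 2) := by
            rw [hK₂_def]; ring
        _ ≤ K_I * min ((L : ℝ) ^ 2 * ∑ i, ‖t i‖ ^ 2) 1 :=
            mul_le_mul_of_nonneg_left (min_mul_sum_sq_ge hd1 (L : ℝ) t) hKI.le
        _ ≤ (latticeFourier Fc t).re := h
    obtain ⟨C, hC⟩ := h24 d hd2' K₁ K₂ ρ s hK₁ hK₂ hρ hs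
    refine ⟨C, fun x => ?_⟩
    have h := hC Fc hFsymm hFdec hF0 hIR2 x
    rw [hGeq x]
    have hmain : gaussianAmp d / (-(∑' y, euclidNorm y ^ 2 * Fc y) * jnorm x ^ ((d : ℝ) - 2)) =
        lam * gaussianAmp d / (soVariance d L * jnorm x ^ ((d : ℝ) - 2)) := by
      rw [hFpp]
      have hj : jnorm x ^ ((d : ℝ) - 2) ≠ 0 := (Real.rpow_pos_of_pos (jnorm_pos x) _).ne'
      field_simp
    rwa [hmain] at h

/-- **Liu–Slade 2026, Theorem 1.7 (corrected transcription `LiuSlade2026_thm1_7`) from the named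
inputs of its printed proof**: Theorem 2.2 (Gaussian deconvolution), the infrared bound (2.3),
Proposition 1.2 (1.9) with (1.8) (only through `S_1(x)|x|^{d-2} → a_d/σ²`; (1.10) is a hypothesis
of the theorem), Proposition 4.1 (⊇ Prop. 1.6), and Liu–Slade 2024, Thm. 1.2 (critical case) for
the error display (1.21); everything else — the bootstrap (Prop. 2.3 and the forbidden interval),
(2.5)–(2.6), Fourier inversion on `ℓ¹` and `ℓ²`, the criticality `F̂_{z_c}(0) = 0`, transience —
being proved in the tree. The `L`-thresholds: `ε₀ = 1`; `L₂` is where the assumptions hold and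
`|o(1)| ≤ 1`, `β = C|K_h|L^{-(2-ε)}` is below the smallness thresholds of the inputs and of
(2.5)–(2.6), and the bootstrap inequality (2.17) closes ("for sufficiently large `L` (we emphasise
that `L` is taken large here independently of `z`)"). [cite: LiuSlade2026, Theorem 1.7 and its proof (§2.2); §1.3] -/
theorem LiuSlade2026_thm1_7_of_parts (h22 : LiuSlade2026_thm22) (hIRf : LiuSlade2026_infraredBound)
    (h12 : LiuSlade2026_prop12_asymp) (h18 : srwGreen_asymp) (h41 : LiuSlade2026_prop41)
    (h24 : LiuSlade2024_thm12_critical) : LiuSlade2026_thm1_7 := by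
  intro d hd ρ hρ
  have hρ0 : 0 < ρ := lt_of_le_of_lt (le_max_right _ _) hρ
  have hd1 : 1 ≤ d := by omega
  have hd2' : 2 < d := by omega
  obtain ⟨βs₂, hβs₂, c, hc, C₂, L₀₂, H22⟩ := h22 d hd2' ρ hρ
  obtain ⟨βsI, hβsI, K_I, hKI, L₀I, HIR⟩ := hIRf d hd1 ρ hρ
  obtain ⟨K, hK, HE⟩ := exists_lsLambda_estimates d hd1 hρ0
  obtain ⟨βs₄, hβs₄, C₄, hC₄, H4⟩ := exists_impulse_of_assumptionH h41 hd1 hρ0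
  obtain ⟨L₀₉, HS1⟩ := tendsto_soGreen_one_mul_rpow h12 h18 hd2'
  refine ⟨1, one_pos, ?_⟩
  intro ε hε hε1 K_S hKS hSx G zc K_h η hη hGHx
  obtain ⟨L₀S, hS⟩ := hSx
  obtain ⟨L₁, hGH⟩ := hGHx
  have hA0 : 0 ≤ C₄ * |K_h| := by positivity
  -- the `L`-dependent small quantities tend to `0`
  have hu : Tendsto (fun L : ℕ => (L : ℝ) ^ (-(2 - ε))) atTop (𝓝 0) :=
    (tendsto_rpow_neg_atTop (by linarith : (0 : ℝ) < 2 - ε)).comp tendsto_natCast_atTop_atTop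
  have hv : Tendsto (fun L : ℕ => (L : ℝ) ^ (-c)) atTop (𝓝 0) :=
    (tendsto_rpow_neg_atTop hc).comp tendsto_natCast_atTop_atTop
  have hηabs : Tendsto (fun L : ℕ => |η L|) atTop (𝓝 0) := by simpa using hη.abs
  have e1 : ∀ᶠ L : ℕ in atTop, |η L| < 1 := hηabs.eventually_lt_const one_pos
  have e2 : ∀ᶠ L : ℕ in atTop, |K_h| * (L : ℝ) ^ (-(2 - ε)) < βs₄ := by
    have h := hu.const_mul |K_h|
    rw [mul_zero] at h
    exact h.eventually_lt_const hβs₄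
  have e3 : ∀ᶠ L : ℕ in atTop, C₄ * |K_h| * (L : ℝ) ^ (-(2 - ε)) < min βs₂ βsI := by
    have h := hu.const_mul (C₄ * |K_h|)
    rw [mul_zero] at h
    exact h.eventually_lt_const (lt_min hβs₂ hβsI)
  have e5 : ∀ᶠ L : ℕ in atTop, K * (C₄ * |K_h| * (L : ℝ) ^ (-(2 - ε))) < 1 / 2 := by
    have h := (hu.const_mul (C₄ * |K_h|)).const_mul K
    rw [mul_zero, mul_zero] at h
    exact h.eventually_lt_const one_half_pos
  have e6 : ∀ᶠ L : ℕ in atTop,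
      2 * K * (C₄ * |K_h|) * K_S * (L : ℝ) ^ (-(2 - ε)) +
        |C₂| * (C₄ * |K_h|) * ((L : ℝ) ^ (-c) + C₄ * |K_h| * (L : ℝ) ^ (-(2 - ε)) + |η L|) < K_S := by
    have h := (hu.const_mul (2 * K * (C₄ * |K_h|) * K_S)).add
      (((hv.add (hu.const_mul (C₄ * |K_h|))).add hηabs).const_mul (|C₂| * (C₄ * |K_h|)))
    simp only [mul_zero, add_zero] at h
    exact h.eventually_lt_const hKS
  obtain ⟨N, hN⟩ := Filter.eventually_atTop.1 (((e1.and e2).and e3).and (e5.and e6))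
  -- the threshold
  refine ⟨max N (max L₁ (max L₀S (max L₀₂ (max L₀I (max L₀₉ 1))))), ?_⟩
  -- the per-`L` statement
  have hper : ∀ L : ℕ, max N (max L₁ (max L₀S (max L₀₂ (max L₀I (max L₀₉ 1))))) ≤ L →
      ∃ lamL : ℝ,
        |lamL - 1| ≤ 2 * K * (C₄ * |K_h|) * (L : ℝ) ^ (-(2 - ε)) ∧
        Tendsto (fun x : Site d => G L (zc L) x * euclidNorm x ^ ((d : ℝ) - 2)) cofinite
          (𝓝 (lamL * gaussianAmp d / soVariance d L)) ∧
        ∀ s : ℝ, s < min (min ρ 2) (ρ - ((d : ℝ) - 8) / 2) → ∃ Kc : ℝ, ∀ x : Site d,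
          |G L (zc L) x - lamL * gaussianAmp d / (soVariance d L * jnorm x ^ ((d : ℝ) - 2))| ≤
            Kc / jnorm x ^ ((d : ℝ) - 2 + s) := by
    intro L hL
    simp only [max_le_iff] at hL
    obtain ⟨hLN, hL₁, hLS, hL2, hLI, hL9, hL1⟩ := hL
    obtain ⟨⟨⟨h1, h2⟩, h3⟩, h5, h6⟩ := hN L hLN
    have hmax1 : max 1 |η L| = 1 := max_eq_left h1.le
    have hsmall4 : |K_h| * (L : ℝ) ^ (-(2 - ε)) * max 1 |η L| ≤ βs₄ := by
      rw [hmax1, mul_one]; exact h2.le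
    have hsmall2 : C₄ * |K_h| * (L : ℝ) ^ (-(2 - ε)) ≤ βs₂ := h3.le.trans (min_le_left _ _)
    have hsmallI : C₄ * |K_h| * (L : ℝ) ^ (-(2 - ε)) ≤ βsI := h3.le.trans (min_le_right _ _)
    have H4L : ImpulseAt d L ρ ε K_S K_h (η L) (zc L) (G L) βs₄ C₄ :=
      fun z hsm hH' hz hb hbdd => H4 L ε K_S K_h (η L) (zc L) z (G L) hsm hH' hz hb hbdd
    have H22L : Thm22At d L ρ βs₂ c C₂ := H22 L hL2
    have HEL : EstimatesAt d L ρ K := HE L hL1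
    have HIRL : IRAt d L ρ βsI K_I := HIR L hLI
    exact thm1_7_at_level hd hL1 hρ hKS (hGH L hL₁).1 (hGH L hL₁).2 (hS L hLS) hC₄ H4L hsmall4
      h1.le H22L hsmall2 hK HEL h5.le h6.le hKI HIRL hsmallI h24 (HS1 L hL9 hL1)
  -- the function `λ(L)` by choice
  refine ⟨fun L => if h : max N (max L₁ (max L₀S (max L₀₂ (max L₀I (max L₀₉ 1))))) ≤ L then
      Classical.choose (hper L h) else 1, ⟨2 * K * (C₄ * |K_h|), fun L hL => ?_⟩, fun L hL => ?_⟩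
  · simp only [dif_pos hL]
    exact (Classical.choose_spec (hper L hL)).1
  · simp only [dif_pos hL]
    exact (Classical.choose_spec (hper L hL)).2

end AssemblyPrelims

/-! ## The trust base after the assembly -/

/-- **The corrected Theorem 1.7 from the four remaining named analysis inputs** — Theorem 2.2,
Proposition 1.2 (1.9), the asymptotics (1.8) of `C_1`, and Liu–Slade 2024 Thm. 1.2 (critical
case) — the infrared bound (2.3) and Proposition 4.1 being the tree's theorems
`LiuSlade2026_infraredBound_holds` (`…PartsInfrared.lean`) and `LiuSlade2026_prop41_holds`
(`…PartsProofs.lean`). [cite: LiuSlade2026, Theorem 1.7 and §1.3] -/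
theorem LiuSlade2026_thm1_7_of_four_facts (h22 : LiuSlade2026_thm22) (h12 : LiuSlade2026_prop12_asymp)
    (h18 : srwGreen_asymp) (h24 : LiuSlade2024_thm12_critical) : LiuSlade2026_thm1_7 :=
  LiuSlade2026_thm1_7_of_parts h22 LiuSlade2026_infraredBound_holds h12 h18 LiuSlade2026_prop41_holds h24

/-- **Sakai's Theorem 1.3 (spread-out) from five named facts**: the four analysis inputs of
Theorem 1.7 above and Sakai's lace expansion with diagrammatic bounds
(`Sakai2007_isingAssumptionH`); Liu–Slade's Prop. 1.2 (1.10), the infrared bound and Prop. 4.1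
being proved in the tree, and every clause of Assumption 1.3 for the Ising model a theorem
(`LaceExpansionIsingRandomWalkBound.lean`). [cite: Sakai2007, Theorem 1.3 (SO model)] [cite: LiuSlade2026, Theorem 1.7] -/
theorem Sakai2007_thm13_spreadOut_of_five_facts (h22 : LiuSlade2026_thm22)
    (h12 : LiuSlade2026_prop12_asymp) (h18 : srwGreen_asymp) (h24 : LiuSlade2024_thm12_critical)
    (h2 : Sakai2007_isingAssumptionH) : Sakai2007_thm13_spreadOut :=
  Sakai2007_thm13_spreadOut_of_three_facts' LiuSlade2026_prop12_greenBound_holds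
    (LiuSlade2026_thm1_7_of_four_facts h22 h12 h18 h24) h2

/-- **The barrier `LaceExpansionIsingAboveFour` from seven named facts** — Aizenman's bubble bound
for the nearest-neighbour and for the spread-out model, the four analysis inputs of Theorem 1.7,
and Sakai's lace expansion with diagrammatic bounds — refining
`LaceExpansionIsingAboveFour_of_five_facts'` (whose hypothesis `LiuSlade2026_thm1_7` is now
reduced to those four and whose `LiuSlade2026_prop12_greenBound` is proved).
[cite: Sakai2007, §1.1 and Theorem 1.3] [cite: LiuSlade2026, Theorem 1.7] -/
theorem LaceExpansionIsingAboveFour_of_seven_facts (h₁ : NNIsing.bubble_susceptibility_upper)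
    (h₂ : bubble_susceptibility_upper) (h22 : LiuSlade2026_thm22)
    (h12 : LiuSlade2026_prop12_asymp) (h18 : srwGreen_asymp) (h24 : LiuSlade2024_thm12_critical)
    (h₅ : Sakai2007_isingAssumptionH) : LaceExpansionIsingAboveFour :=
  LaceExpansionIsingAboveFour_of_facts h₁ h₂ (Sakai2007_thm13_spreadOut_of_five_facts h22 h12 h18 h24 h₅)

end Literature.Barriers.CriticalPhenomena.SpreadOutIsing

end
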